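import Summits.HubbardSuperconductivity.HubbardSuperconductivity.Theorems.WidthHaldaneTubeProfileGauge

/-!
# Leggett's variational bound: the flux cost is at most `Σ_a (1 - cos φ_a)·k_a(ψ)` for EVERY
# distribution `(φ_a)` of the twist over the cuts of the tube

Crux `WidthHaldaneBridge` (stmt-HubbardSuperconductivity-16311), crux idea `twist-transfer-floors`
(2026-08-17 round; line registered 11:02Z with stubs `stub_cutFloor`, `stub_leggettFloor`): with the
profile-gauge identities of `Theorems/WidthHaldaneTubeProfileGauge.lean` (site phases `g_z = e^{iΦ(z₁)}`
put the Peierls phase `e^{iφ_a}`, `φ_a = Φ(a) - Φ(a-1) + θ·[a = 0]`, on the cut between the columns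
`a - 1` and `a`), pricing a `θ = 0` ground state `ψ` in the two orientations `(Φ, θ)`, `(-Φ, -θ)`
(the bond currents cancel, `E(-θ) = E(θ)`) gives, for every normalised `(N, S^z = 0)` sector ground
state `ψ` of `tubeH0` (`L ≥ 3`) and EVERY column potential `Φ`:

  **`E(θ) - E(0) ≤ Σ_a (1 - cos φ_a) · k_a(ψ)`**,
  `k_a(ψ) = Σ_{b,σ} Re⟨ψ, (c†_{(a,b)σ} c_{(a-1,b)σ} + c†_{(a-1,b)σ} c_{(a,b)σ}) ψ⟩`

(Leggett 1970; Paramekanti–Trivedi–Randeria 1998 §IV, eq. (var-bd)). All the twist on one cut gives the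
per-cut floor; `φ_a ∝ 1/k_a` gives Leggett's harmonic-mean floor; the uniform profile is the kinetic
floor of `Theorems/WidthHaldaneKineticFloor.lean`.

Everything is PROVED here (no definition, no named fact):

* `profileWeight_neg`, `summand_pm_profile_eq` — the `±` trick pointwise: the two orientations weigh an
  amplitude by `(2 - 2cos φ(x₁))` / `(2 - 2cos φ(y₁))` on the two longitudinal orientations, `0` else;
* `sum_longitudinal_weight_eq` — the column bookkeeping with cut-dependent weights;
* **`tubeEnergy_sub_le_profile`** — the displayed bound; `leggettVariationalBound` — closed form (the
  registered sub-goal).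

References: A. J. Leggett, PRL 25 (1970) 1543; A. Paramekanti, N. Trivedi, M. Randeria, PRB 57
(1998) 11639, §IV; H. Watanabe, J. Stat. Phys. 177 (2019) 717, §2.2.
-/

noncomputable section

namespace Summit.HubbardSuperconductivity.HubbardSuperconductivity.Theorems.WidthHaldane

set_option linter.dupNamespace false -- summit = problem name (single-conjunct summit), D-0017

open scoped BigOperators Classical Matrix ComplexConjugate
open Matrix Literature.MathematicalPhysics.QuantumLattice

section Leggett

variable (L M : ℕ) [NeZero L] [NeZero M] (Λ : Type) [LinearOrder Λ] [Fintype Λ]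
  (e : Λ ≃ ZMod L × ZMod M)

omit [NeZero L] [NeZero M] [LinearOrder Λ] [Fintype Λ] in
/-- Reversing the potential and the flux conjugates the profile weights. [folklore] -/
theorem profileWeight_neg (Φ : ZMod L → ℝ) (θ : ℝ) (x y : Λ) :
    (if (e x).1 = (e y).1 + 1 ∧ (e x).2 = (e y).2 then
        Complex.exp ((((-Φ) (e x).1 - (-Φ) ((e x).1 - 1) + if (e x).1 = 0 then -θ else 0 : ℝ) : ℂ) * Complex.I)
      else if (e y).1 = (e x).1 + 1 ∧ (e x).2 = (e y).2 then
        Complex.exp (-(((((-Φ) (e y).1 - (-Φ) ((e y).1 - 1) + if (e y).1 = 0 then -θ else 0 : ℝ) : ℂ)) * Complex.I))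
      else 1) =
    conj (if (e x).1 = (e y).1 + 1 ∧ (e x).2 = (e y).2 then
        Complex.exp (((Φ (e x).1 - Φ ((e x).1 - 1) + if (e x).1 = 0 then θ else 0 : ℝ) : ℂ) * Complex.I)
      else if (e y).1 = (e x).1 + 1 ∧ (e x).2 = (e y).2 then
        Complex.exp (-((((Φ (e y).1 - Φ ((e y).1 - 1) + if (e y).1 = 0 then θ else 0 : ℝ) : ℂ)) * Complex.I))
      else 1) := by
  split_ifs <;>
    first
    | rw [map_one]
    | (rw [← Complex.exp_conj]
       congr 1
       simp only [map_mul, map_neg, Complex.conj_ofReal, Complex.conj_I, Pi.neg_apply]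
       push_cast
       ring)

omit [NeZero L] [NeZero M] [Fintype Λ] in
/-- **The `±` profile weights, pointwise** (`L ≥ 3`): on an adjacent pair the two orientations
`(Φ, θ)`, `(-Φ, -θ)` weigh the amplitude `h` by `(2 - 2cos φ(x₁))·Re h` if `x = y + e₁`, by
`(2 - 2cos φ(y₁))·Re h` if `y = x + e₁`, and by `0` transversally. [cite: Watanabe2019, §2.2.1 (twist operator U_m)] -/
theorem summand_pm_profile_eq (hL : 3 ≤ L) (Φ : ZMod L → ℝ) (θ : ℝ) (x y : Λ) (h : ℂ) :
    (if (tubeGraph e).Adj x y then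
        ((1 - (if (e x).1 = (e y).1 + 1 ∧ (e x).2 = (e y).2 then
            Complex.exp (((Φ (e x).1 - Φ ((e x).1 - 1) + if (e x).1 = 0 then θ else 0 : ℝ) : ℂ) * Complex.I)
          else if (e y).1 = (e x).1 + 1 ∧ (e x).2 = (e y).2 then
            Complex.exp (-((((Φ (e y).1 - Φ ((e y).1 - 1) + if (e y).1 = 0 then θ else 0 : ℝ) : ℂ)) * Complex.I))
          else 1)) * h).re else 0) +
      (if (tubeGraph e).Adj x y then
        ((1 - (if (e x).1 = (e y).1 + 1 ∧ (e x).2 = (e y).2 then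
            Complex.exp ((((-Φ) (e x).1 - (-Φ) ((e x).1 - 1) + if (e x).1 = 0 then -θ else 0 : ℝ) : ℂ) * Complex.I)
          else if (e y).1 = (e x).1 + 1 ∧ (e x).2 = (e y).2 then
            Complex.exp (-(((((-Φ) (e y).1 - (-Φ) ((e y).1 - 1) + if (e y).1 = 0 then -θ else 0 : ℝ) : ℂ)) * Complex.I))
          else 1)) * h).re else 0) =
      ((if (e x).1 = (e y).1 + 1 ∧ (e x).2 = (e y).2 then
          2 - 2 * Real.cos (Φ (e x).1 - Φ ((e x).1 - 1) + if (e x).1 = 0 then θ else 0) else 0) +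
        (if (e y).1 = (e x).1 + 1 ∧ (e x).2 = (e y).2 then
          2 - 2 * Real.cos (Φ (e y).1 - Φ ((e y).1 - 1) + if (e y).1 = 0 then θ else 0) else 0)) * h.re := by
  haveI : Fact (1 < L) := ⟨by omega⟩
  rw [profileWeight_neg]
  obtain ⟨⟨a, b⟩, rfl⟩ := e.symm.surjective x
  obtain ⟨⟨a', b'⟩, rfl⟩ := e.symm.surjective y
  by_cases hadj : (tubeGraph e).Adj (e.symm (a, b)) (e.symm (a', b'))
  · rw [if_pos hadj, if_pos hadj, re_pm_pointwise]
    simp only [Equiv.apply_symm_apply, SimpleGraph.fromRel_adj, tubeGraph, ne_eq,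
      EmbeddingLike.apply_eq_iff_eq, Prod.mk.injEq] at hadj ⊢
    by_cases h1 : a = a' + 1 ∧ b = b'
    · have h2 : ¬ (a' = a + 1 ∧ b = b') := fun h2 => not_both_steps L hL h1.1 h2.1
      rw [if_pos h1, if_pos h1, if_neg h2, Complex.exp_ofReal_mul_I_re]
      ring
    · by_cases h2 : a' = a + 1 ∧ b = b'
      · rw [if_neg h1, if_pos h2, if_neg h1, if_pos h2, ← neg_mul, ← Complex.ofReal_neg,
          Complex.exp_ofReal_mul_I_re, Real.cos_neg]
        ring
      · rw [if_neg h1, if_neg h2, if_neg h1, if_neg h2, Complex.one_re]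
        ring
  · rw [if_neg hadj, if_neg hadj]
    simp only [Equiv.apply_symm_apply, SimpleGraph.fromRel_adj, tubeGraph, ne_eq,
      EmbeddingLike.apply_eq_iff_eq, Prod.mk.injEq] at hadj ⊢
    have h1 : ¬ (a = a' + 1 ∧ b = b') := fun h =>
      hadj ⟨fun h0 => one_ne_zero (by linear_combination h.1.symm.trans h0.1 : (1 : ZMod L) = 0),
        Or.inr (Or.inl h)⟩
    have h2 : ¬ (a' = a + 1 ∧ b = b') := fun h =>
      hadj ⟨fun h0 => one_ne_zero (by linear_combination h.1.symm.trans h0.1.symm : (1 : ZMod L) = 0),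
        Or.inl (Or.inl ⟨h.1, h.2.symm⟩)⟩
    rw [if_neg h1, if_neg h2]
    ring

/-- **The longitudinal hop sum with cut-dependent weights, in column coordinates**:
`Σ_{x,y,σ} ([x = y + e₁]·w(x₁) + [y = x + e₁]·w(y₁))·r(x,y,σ) = Σ_a w(a)·Σ_{b,σ} (r((a,b),(a-1,b),σ) + r((a-1,b),(a,b),σ))`.
[folklore] -/
theorem sum_longitudinal_weight_eq (w : ZMod L → ℝ) (r : Λ → Λ → Fin 2 → ℝ) :
    ∑ x : Λ, ∑ y : Λ, ∑ σ : Fin 2,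
        ((if (e x).1 = (e y).1 + 1 ∧ (e x).2 = (e y).2 then w (e x).1 else 0) +
          (if (e y).1 = (e x).1 + 1 ∧ (e x).2 = (e y).2 then w (e y).1 else 0)) * r x y σ =
      ∑ a : ZMod L, w a * ∑ b : ZMod M, ∑ σ : Fin 2,
        (r (e.symm (a, b)) (e.symm (a - 1, b)) σ + r (e.symm (a - 1, b)) (e.symm (a, b)) σ) := by
  have hx : ∀ x : Λ, ∑ y : Λ, ∑ σ : Fin 2,
      ((if (e x).1 = (e y).1 + 1 ∧ (e x).2 = (e y).2 then w (e x).1 else 0) +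
        (if (e y).1 = (e x).1 + 1 ∧ (e x).2 = (e y).2 then w (e y).1 else 0)) * r x y σ =
      ∑ σ : Fin 2, (w (e x).1 * r x (e.symm ((e x).1 - 1, (e x).2)) σ +
        w ((e x).1 + 1) * r x (e.symm ((e x).1 + 1, (e x).2)) σ) := by
    intro x
    rw [Finset.sum_comm]
    refine Finset.sum_congr rfl fun σ _ => ?_
    simp only [longitudinal_iff_left, longitudinal_iff_right, add_mul, ite_mul, zero_mul,
      Finset.sum_add_distrib, Finset.sum_ite_eq', Finset.mem_univ, if_true, Equiv.apply_symm_apply]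
  simp only [hx, Finset.sum_add_distrib]
  have hcoord : ∀ F : Λ → ℝ, ∑ x : Λ, F x = ∑ a : ZMod L, ∑ b : ZMod M, F (e.symm (a, b)) := by
    intro F
    rw [← Fintype.sum_prod_type', ← Equiv.sum_comp e.symm]
  rw [hcoord, hcoord]
  simp only [Equiv.apply_symm_apply, ← Finset.mul_sum]
  simp only [mul_add, Finset.sum_add_distrib]
  congr 1
  exact Fintype.sum_equiv (Equiv.addRight (1 : ZMod L)) _ _
    (fun a => by simp only [Equiv.coe_addRight, add_sub_cancel_right])

/-- **LEGGETT'S VARIATIONAL BOUND** (`L ≥ 3`): for every column potential `Φ : ℤ/L → ℝ`, every flux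
`θ` and every normalised `(N, S^z = 0)` sector ground state `ψ` of the pure tube,
`E_{L,M}(U; θ, N) - E_{L,M}(U; 0, N) ≤ Σ_a (1 - cos φ_a)·k_a(ψ)` with the bond phases
`φ_a = Φ(a) - Φ(a-1) + θ·[a = 0]` (which sum to `θ`) and the cut kinetic energies
`k_a(ψ) = Σ_{b,σ} Re⟨ψ, (c†_{(a,b)σ}c_{(a-1,b)σ} + c†_{(a-1,b)σ}c_{(a,b)σ}) ψ⟩`. Leggett, PRL 25 (1970)
1543; Paramekanti–Trivedi–Randeria, PRB 57 (1998) 11639, §IV eq. (var-bd). [cite: Leggett1970] -/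
theorem tubeEnergy_sub_le_profile (hL : 3 ≤ L) (Φ : ZMod L → ℝ) (U θ : ℝ) (N : ℕ) {ψ : Fock (Orb Λ)}
    (h1 : star ψ ⬝ᵥ ψ = 1) (hgs : IsGroundStateInSector (tubeH0 L M Λ e U) N 0 ψ) :
    tubeEnergy L M Λ e U θ N - tubeEnergy L M Λ e U 0 N ≤
      ∑ a : ZMod L, (1 - Real.cos (Φ a - Φ (a - 1) + if a = 0 then θ else 0)) *
        ∑ b : ZMod M, ∑ σ : Fin 2,
          (expect (creation (orb (e.symm (a, b)) σ) * annihilation (orb (e.symm (a - 1, b)) σ) +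
            creation (orb (e.symm (a - 1, b)) σ) * annihilation (orb (e.symm (a, b)) σ)) ψ).re := by
  -- the variational bound in the profile gauge, for both orientations
  have hgauge : ∀ (Φ' : ZMod L → ℝ) (θ' : ℝ), tubeEnergy L M Λ e U θ' N ≤
      (expect (phaseGauge (fun z : Λ => Circle.exp (Φ' (e z).1)) *
        (tubeH0 L M Λ e U + tubeTwist L M Λ e θ') *
        (phaseGauge (fun z : Λ => Circle.exp (Φ' (e z).1)))ᴴ) ψ).re := by
    intro Φ' θ'
    set g : Λ → Circle := fun z : Λ => Circle.exp (Φ' (e z).1) with hg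
    have hunit := minEnergyOn_szSector_phaseGauge_conj g⁻¹ (tubeH0 L M Λ e U + tubeTwist L M Λ e θ') N 0
    rw [phaseGauge_conjTranspose, inv_inv, ← phaseGauge_conjTranspose g] at hunit
    rw [tubeEnergy_eq, ← hunit]
    exact minEnergyOn_le_rayleigh_of_mem
      (Matrix.isHermitian_mul_mul_conjTranspose _ (isHermitian_tubeH L M Λ e U θ')) _ hgs.1 h1
  have hp := hgauge Φ θ
  have hm := hgauge (-Φ) (-θ)
  rw [tubeEnergy_neg] at hm
  rw [re_expect_profileGauged_tubeH L M Λ e hL] at hp hm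
  -- for a sector ground state `Re⟨ψ, H₀ψ⟩ = E(0)`
  have hE : (expect (tubeH0 L M Λ e U) ψ).re = tubeEnergy L M Λ e U 0 N := by
    rw [expect, hgs.2.2, dotProduct_smul, h1, smul_eq_mul, mul_one, Complex.ofReal_re, tubeEnergy_zero]
  rw [hE] at hp hm
  -- add the two bounds
  have hsum : (∑ x : Λ, ∑ y : Λ, ∑ σ : Fin 2, if (tubeGraph e).Adj x y then
      ((1 - (if (e x).1 = (e y).1 + 1 ∧ (e x).2 = (e y).2 then
          Complex.exp (((Φ (e x).1 - Φ ((e x).1 - 1) + if (e x).1 = 0 then θ else 0 : ℝ) : ℂ) * Complex.I)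
        else if (e y).1 = (e x).1 + 1 ∧ (e x).2 = (e y).2 then
          Complex.exp (-((((Φ (e y).1 - Φ ((e y).1 - 1) + if (e y).1 = 0 then θ else 0 : ℝ) : ℂ)) * Complex.I))
        else 1)) * expect (creation (orb x σ) * annihilation (orb y σ)) ψ).re else 0) +
      (∑ x : Λ, ∑ y : Λ, ∑ σ : Fin 2, if (tubeGraph e).Adj x y then
      ((1 - (if (e x).1 = (e y).1 + 1 ∧ (e x).2 = (e y).2 then
          Complex.exp ((((-Φ) (e x).1 - (-Φ) ((e x).1 - 1) + if (e x).1 = 0 then -θ else 0 : ℝ) : ℂ) * Complex.I)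
        else if (e y).1 = (e x).1 + 1 ∧ (e x).2 = (e y).2 then
          Complex.exp (-(((((-Φ) (e y).1 - (-Φ) ((e y).1 - 1) + if (e y).1 = 0 then -θ else 0 : ℝ) : ℂ)) * Complex.I))
        else 1)) * expect (creation (orb x σ) * annihilation (orb y σ)) ψ).re else 0) =
      ∑ a : ZMod L, (2 - 2 * Real.cos (Φ a - Φ (a - 1) + if a = 0 then θ else 0)) *
        ∑ b : ZMod M, ∑ σ : Fin 2,
          (expect (creation (orb (e.symm (a, b)) σ) * annihilation (orb (e.symm (a - 1, b)) σ) +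
            creation (orb (e.symm (a - 1, b)) σ) * annihilation (orb (e.symm (a, b)) σ)) ψ).re := by
    rw [← Finset.sum_add_distrib]
    have hpt : ∀ x : Λ, (∑ y : Λ, ∑ σ : Fin 2, (if (tubeGraph e).Adj x y then
        ((1 - (if (e x).1 = (e y).1 + 1 ∧ (e x).2 = (e y).2 then
            Complex.exp (((Φ (e x).1 - Φ ((e x).1 - 1) + if (e x).1 = 0 then θ else 0 : ℝ) : ℂ) * Complex.I)
          else if (e y).1 = (e x).1 + 1 ∧ (e x).2 = (e y).2 then
            Complex.exp (-((((Φ (e y).1 - Φ ((e y).1 - 1) + if (e y).1 = 0 then θ else 0 : ℝ) : ℂ)) * Complex.I))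
          else 1)) * expect (creation (orb x σ) * annihilation (orb y σ)) ψ).re else 0)) +
        (∑ y : Λ, ∑ σ : Fin 2, (if (tubeGraph e).Adj x y then
        ((1 - (if (e x).1 = (e y).1 + 1 ∧ (e x).2 = (e y).2 then
            Complex.exp ((((-Φ) (e x).1 - (-Φ) ((e x).1 - 1) + if (e x).1 = 0 then -θ else 0 : ℝ) : ℂ) * Complex.I)
          else if (e y).1 = (e x).1 + 1 ∧ (e x).2 = (e y).2 then
            Complex.exp (-(((((-Φ) (e y).1 - (-Φ) ((e y).1 - 1) + if (e y).1 = 0 then -θ else 0 : ℝ) : ℂ)) * Complex.I))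
          else 1)) * expect (creation (orb x σ) * annihilation (orb y σ)) ψ).re else 0)) =
        ∑ y : Λ, ∑ σ : Fin 2,
          ((if (e x).1 = (e y).1 + 1 ∧ (e x).2 = (e y).2 then
              2 - 2 * Real.cos (Φ (e x).1 - Φ ((e x).1 - 1) + if (e x).1 = 0 then θ else 0) else 0) +
            (if (e y).1 = (e x).1 + 1 ∧ (e x).2 = (e y).2 then
              2 - 2 * Real.cos (Φ (e y).1 - Φ ((e y).1 - 1) + if (e y).1 = 0 then θ else 0) else 0)) *
            (expect (creation (orb x σ) * annihilation (orb y σ)) ψ).re := by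
      intro x
      rw [← Finset.sum_add_distrib]
      refine Finset.sum_congr rfl fun y _ => ?_
      rw [← Finset.sum_add_distrib]
      refine Finset.sum_congr rfl fun σ _ => ?_
      exact summand_pm_profile_eq L M Λ e hL Φ θ x y _
    rw [Finset.sum_congr rfl fun x _ => hpt x,
      sum_longitudinal_weight_eq L M Λ e (fun a => 2 - 2 * Real.cos (Φ a - Φ (a - 1) + if a = 0 then θ else 0))]
    refine Finset.sum_congr rfl fun a _ => ?_
    congr 1
    refine Finset.sum_congr rfl fun b _ => Finset.sum_congr rfl fun σ _ => ?_
    rw [expect_add, Complex.add_re]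
  -- `2(E(θ) - E(0)) ≤ Σ_a (2 - 2cos φ_a) k_a`
  have h2 : 2 * (tubeEnergy L M Λ e U θ N - tubeEnergy L M Λ e U 0 N) ≤
      ∑ a : ZMod L, (2 - 2 * Real.cos (Φ a - Φ (a - 1) + if a = 0 then θ else 0)) *
        ∑ b : ZMod M, ∑ σ : Fin 2,
          (expect (creation (orb (e.symm (a, b)) σ) * annihilation (orb (e.symm (a - 1, b)) σ) +
            creation (orb (e.symm (a - 1, b)) σ) * annihilation (orb (e.symm (a, b)) σ)) ψ).re := by
    rw [← hsum]
    linarith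
  have hhalf : ∑ a : ZMod L, (2 - 2 * Real.cos (Φ a - Φ (a - 1) + if a = 0 then θ else 0)) *
        ∑ b : ZMod M, ∑ σ : Fin 2,
          (expect (creation (orb (e.symm (a, b)) σ) * annihilation (orb (e.symm (a - 1, b)) σ) +
            creation (orb (e.symm (a - 1, b)) σ) * annihilation (orb (e.symm (a, b)) σ)) ψ).re =
      2 * ∑ a : ZMod L, (1 - Real.cos (Φ a - Φ (a - 1) + if a = 0 then θ else 0)) *
        ∑ b : ZMod M, ∑ σ : Fin 2,
          (expect (creation (orb (e.symm (a, b)) σ) * annihilation (orb (e.symm (a - 1, b)) σ) +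
            creation (orb (e.symm (a - 1, b)) σ) * annihilation (orb (e.symm (a, b)) σ)) ψ).re := by
    rw [Finset.mul_sum]
    refine Finset.sum_congr rfl fun a _ => ?_
    ring
  rw [hhalf] at h2
  linarith

end Leggett

/-- **LEGGETT'S VARIATIONAL BOUND, closed form** (all binders universally quantified; the registered
sub-goal `leggettVariationalBound` of crux stmt-HubbardSuperconductivity-16311): for every labelled
tube with `L ≥ 3`, every `U`, `θ`, `N`, every column potential `Φ` and every normalised `(N, S^z = 0)`
sector ground state `ψ` of `tubeH0`, `E(θ) - E(0) ≤ Σ_a (1 - cos φ_a)·k_a(ψ)`,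
`φ_a = Φ(a) - Φ(a-1) + θ·[a = 0]`. [cite: Leggett1970] -/
theorem leggettVariationalBound : ∀ (L M : ℕ) [NeZero L] [NeZero M] (Λ : Type) [LinearOrder Λ] [Fintype Λ] (e : Λ ≃ ZMod L × ZMod M), 3 ≤ L → ∀ (Φ : ZMod L → ℝ) (U θ : ℝ) (N : ℕ) (ψ : Fock (Orb Λ)), star ψ ⬝ᵥ ψ = 1 → IsGroundStateInSector (tubeH0 L M Λ e U) N 0 ψ → tubeEnergy L M Λ e U θ N - tubeEnergy L M Λ e U 0 N ≤ ∑ a : ZMod L, (1 - Real.cos (Φ a - Φ (a - 1) + if a = 0 then θ else 0)) * ∑ b : ZMod M, ∑ σ : Fin 2, (expect (creation (orb (e.symm (a, b)) σ) * annihilation (orb (e.symm (a - 1, b)) σ) + creation (orb (e.symm (a - 1, b)) σ) * annihilation (orb (e.symm (a, b)) σ)) ψ).re :=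
  fun L M _ _ Λ _ _ e hL Φ U θ N _ψ h1 hgs => tubeEnergy_sub_le_profile L M Λ e hL Φ U θ N h1 hgs

end Summit.HubbardSuperconductivity.HubbardSuperconductivity.Theorems.WidthHaldane

end
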